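import Mathlib
import HarnessLib
import Literature.Analysis.FluidPDE.ClassicalSolution
import Literature.Analysis.FluidPDE.LerayHopf
import Literature.Analysis.FluidPDE.NSVorticityBKMEnergy
import Literature.Analysis.FluidPDE.BKMClassTimeDerivativeL2
import Literature.Analysis.FluidPDE.NormalisedPressureDischarge
import Summits.NavierStokesRegularity.NavierStokesRegularity.Theorems.QuarterJoltSliceTestStaticH1
import Summits.NavierStokesRegularity.NavierStokesRegularity.Theorems.QuarterJoltSliceTestIncrementH1

/-!
# Route QuarterJolt — crux `NoTerminalJolt` (stmt-NavierStokesRegularity-26463), LEAD line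
# `regular_split` rev 8: SLICE TESTING, `L⁴` form, I — static estimate with the raw `L⁴` norm of the
# moving slice; the slab increment under an abstract `L⁴` MAJORANT

Seat ns-ntj-p1 g6 (LEAD of the crux; `--supports 26463 --as helper`). First file of the `L⁴`
SLICE-TEST CRITERION chain (THIS → `QuarterJoltL4SliceTestCriterion` →
`QuarterJoltWeakL4EnergyEquality` → `QuarterJoltShinbrotEnergyEquality`): in the first-blow-up frame,
`∫ₜˢ ‖u(τ)‖²_{L⁴} dτ ≤ C√(T−t)` for `t < s < T` near `T` forces the ENERGY EQUALITY at `T` (no energy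
jump). The TYPE-I chain (p638099–p639359) and the ENSTROPHY-RATE chain (p640762–p641804) bound
`‖u(τ)‖²_{L⁴}` through the sup norm resp. Ladyzhenskaya; here it is kept raw, under a MAJORANT `m`.

* `sliceTest_abs_le_of_classical_L4` — at an interior time `τ` of a closed slab `[0,S]` in Tao's
  class, for a frozen `C¹` divergence-free `U` with `U, DU ∈ L²` and every `η > 0`:
  `|∫⟪U, ∂ₜu(τ)⟫| ≤ (ν/2)(η Z_τ + η⁻¹ Z_U) + √(∫‖u(τ)‖⁴) · √Z_U`
  (`sliceTest_abs_le_of_transport` p641070 + `abs_integral_inner_convect_self_le_L4` p640762).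
* `sliceTestL4_increment_abs_le_slab` — `(u,p)` classical on `[0,S]×ℝ³` in Tao's class,
  `0 < t < s < S`, a majorant `√(∫‖u(τ)‖⁴) ≤ m(τ)` on `(t,s)`, a.e.-measurable, with
  `∫⁻_{(t,s)} m ≤ A`: `|∫⟪u(s),u(t)⟫ − ∫‖u(t)‖²| ≤ (ν/2)η(∫⁻_{(t,s)}∫⁻|Du|²_F).toReal
  + (ν/2)η⁻¹ Z (s−t) + √Z · A`, `Z = ∫|Du(t)|²_F` (time integration as in p641443).

HONEST FRAMING: a priori calculus for classical solutions; nothing here concerns the truth of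
`NoTerminalJolt` or Navier–Stokes regularity. No summit statement is proved here. [folklore]
-/

noncomputable section

-- the summit and its single sub-problem share the name (CONVENTIONS §1), as in every Theorems file
set_option linter.dupNamespace false

namespace Summit.NavierStokesRegularity.NavierStokesRegularity.Theorems

open MeasureTheory Set Function Filter Topology InnerProductSpace
open scoped ENNReal NNReal ContDiff RealInnerProductSpace Laplacian
open Literature.Analysis.FluidPDE

namespace NoTerminalJolt

/-! ### The static slice-test estimate, `L⁴` form -/

/-- **The slice-test estimate at an interior time of a closed slab, `L⁴` form.** For `ν > 0`,
`S > 0`, an unforced classical solution `(u, p)` on `[0, S] × ℝ³` in Tao's class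
(`HasBoundedSobolevNormsOn`), an interior time `τ ∈ (0, S)`, and a frozen `C¹` divergence-free field
`U` with `U, DU ∈ L²` (no energy constant and no rate hypothesis enter): for every `η > 0`, with
`Z_τ = ∫|Du(τ)|²_F`, `Z_U = ∫|DU|²_F`,
`|∫⟪U, ∂ₜu(τ)⟫| ≤ (ν/2)(η Z_τ + η⁻¹ Z_U) + √(∫‖u(τ)‖⁴) · √Z_U`
(`sliceTest_abs_le_of_transport` with the transport pairing integrated by parts onto `U`,
`abs_integral_inner_convect_self_le_L4`). The `L⁴` norm of the moving slice is kept raw. [folklore] -/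
theorem sliceTest_abs_le_of_classical_L4 {ν S : ℝ} (hν : 0 < ν) (hS : 0 < S)
    {u : ℝ → EuclideanSpace ℝ (Fin 3) → EuclideanSpace ℝ (Fin 3)} {p : ℝ → EuclideanSpace ℝ (Fin 3) → ℝ}
    (hsol : IsClassicalNSSolutionOn (Icc 0 S) ν 0 u p) (hB : HasBoundedSobolevNormsOn (Icc 0 S) u)
    {τ : ℝ} (hτ : τ ∈ Ioo 0 S)
    {U : EuclideanSpace ℝ (Fin 3) → EuclideanSpace ℝ (Fin 3)}
    (hU : ContDiff ℝ 1 U) (hdivU : VectorCalculus.IsDivFree U)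
    (l2U : ∫⁻ x, ‖U x‖ₑ ^ 2 < ⊤) (l2DU : ∫⁻ x, ‖fderiv ℝ U x‖ₑ ^ 2 < ⊤) {η : ℝ} (hη : 0 < η) :
    |∫ x, ⟪U x, timeDerivWithin (Icc 0 S) u τ x⟫| ≤
      ν / 2 * (η * (∫ x, frobeniusNormSq (fderiv ℝ (u τ) x)) +
          η⁻¹ * ∫ x, frobeniusNormSq (fderiv ℝ U x)) +
        Real.sqrt (∫ x, ‖u τ x‖ ^ 4) * Real.sqrt (∫ x, frobeniusNormSq (fderiv ℝ U x)) := by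
  have hτ' : τ ∈ Icc 0 S := Ioo_subset_Icc_self hτ
  have hu : ∀ t ∈ Icc 0 S, ContDiff ℝ ∞ (u t) := fun t ht => hsol.contDiff_velocity ht
  -- class data: energy and a uniform bound
  obtain ⟨⟨I₁, hI₁⟩, -⟩ := levelSq_bounds_of_hasBoundedSobolevNormsOn hu hB 0
  obtain ⟨B₀, -, hB₀⟩ := exists_forall_norm_iteratedFDeriv_le_bkmClass hu hB 0
  have huB : ∀ t ∈ Icc 0 S, ∀ x, ‖u t x‖ ≤ B₀ := fun t ht x => by
    have := hB₀ t ht x; rwa [norm_iteratedFDeriv_zero] at this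
  have hE_int : ∀ t ∈ Icc 0 S, Integrable fun x => ‖u t x‖ ^ 2 := fun t ht =>
    (hI₁ t ht).1.congr (Eventually.of_forall fun x => levelSq_zero_eq_norm_sq (u t) x)
  have hE_le : ∀ t ∈ Icc 0 S, ∫ x, ‖u t x‖ ^ 2 ≤ I₁ := fun t ht => by
    rw [← integral_congr_ae (Eventually.of_forall fun x => levelSq_zero_eq_norm_sq (u t) x)]
    exact (hI₁ t ht).2
  have hI₁0 : 0 ≤ I₁ := (integral_nonneg fun x => sq_nonneg _).trans (hE_le τ hτ')
  -- the pressure at the interior time `τ` is the normalised one up to a constant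
  obtain ⟨c₀, hc₀⟩ : ∃ c₀ : ℝ, c₀ = p τ 0 - pressurePotential (u τ) 0 := ⟨_, rfl⟩
  have hQ : ∀ x, p τ x = normalisedPressure (u τ) x + c₀ := by
    intro x
    have h1 := pressure_sub_pressurePotential_eq hν.le hsol hI₁0 hE_int hE_le hτ x
    rw [normalisedPressure_eq_pressurePotential ((hu τ hτ').of_le (by norm_cast)) (hE_int τ hτ') x,
      hc₀]
    linarith
  obtain ⟨hQ2, -⟩ := integral_normalisedPressure_sq_le_of_bound (hu τ hτ') (hE_int τ hτ')
    (hE_le τ hτ') (huB τ hτ')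
  obtain ⟨π, hπdef⟩ : ∃ π : EuclideanSpace ℝ (Fin 3) → ℝ, π = fun x => p τ x - c₀ := ⟨_, rfl⟩
  have hπQ : ∀ x, π x = normalisedPressure (u τ) x := fun x => by rw [hπdef]; simp only [hQ x]; ring
  have hπ : ContDiff ℝ 1 π := by
    rw [hπdef]; exact ((hsol.contDiff_pressure hτ').sub contDiff_const).of_le (by norm_cast)
  have hgradπ : ∀ x, gradient π x = gradient (p τ) x := fun x => by
    rw [hπdef, gradient, gradient, fderiv_sub_const]
  have l2π : ∫⁻ x, ‖π x‖ₑ ^ 2 < ⊤ := by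
    have h1 : ∀ x, ‖π x‖ₑ ^ 2 = ‖normalisedPressure (u τ) x ^ 2‖ₑ := fun x => by
      rw [hπQ x, enorm_pow]
    simp_rw [h1]
    exact hQ2.2
  have hmom : ∀ x, timeDerivWithin (Icc 0 S) u τ x + convect (u τ) (u τ) x =
      ν • (Δ (u τ)) x - gradient π x := fun x => by
    rw [hgradπ x]; simpa using hsol.momentum τ hτ' x
  have hW : Continuous (timeDerivWithin (Icc 0 S) u τ) :=
    ((hsol.smooth_velocity.timeDerivWithin (uniqueDiffOn_Icc hS)).contDiff_slice hτ').continuous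
  obtain ⟨Λ, hΛtop, hΛ⟩ := hsol.exists_lintegral_enorm_timeDerivWithin_sq_le hν.le hS hB
  have l2W : ∫⁻ x, ‖timeDerivWithin (Icc 0 S) u τ x‖ₑ ^ 2 < ⊤ :=
    (hΛ τ hτ').trans_lt hΛtop.lt_top
  obtain ⟨C₀, hC₀⟩ := hB 0
  obtain ⟨C₁, hC₁⟩ := hB 1
  obtain ⟨C₂, hC₂⟩ := hB 2
  have l2v : ∫⁻ x, ‖u τ x‖ₑ ^ 2 < ⊤ := by
    refine lt_of_le_of_lt (le_of_eq (lintegral_congr fun x => ?_))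
      ((hC₀ τ hτ').trans_lt ENNReal.coe_lt_top)
    rw [← ofReal_norm, ← ofReal_norm, norm_iteratedFDeriv_zero]
  have l2Dv : ∫⁻ x, ‖fderiv ℝ (u τ) x‖ₑ ^ 2 < ⊤ :=
    lintegral_enorm_sq_lt_top_of_norm_le (fun x => by
      rw [← norm_iteratedFDeriv_fderiv, norm_iteratedFDeriv_zero])
      ((hC₁ τ hτ').trans_lt ENNReal.coe_lt_top)
  have l2D2v : ∫⁻ x, ‖iteratedFDeriv ℝ 2 (u τ) x‖ₑ ^ 2 < ⊤ :=
    (hC₂ τ hτ').trans_lt ENNReal.coe_lt_top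
  have hv1 : ContDiff ℝ 1 (u τ) := (hu τ hτ').of_le (by norm_cast)
  -- the transport bound through the raw `L⁴` norm of the moving slice
  have hT1 := abs_integral_inner_convect_self_le_L4 hU hv1 (hsol.divFree τ hτ') (huB τ hτ') l2v
    l2Dv l2U l2DU
  have hTr : |∫ x, ⟪U x, convect (u τ) (u τ) x⟫| ≤
      Real.sqrt (∫ x, ‖u τ x‖ ^ 4) * Real.sqrt (∫ x, frobeniusNormSq (fderiv ℝ U x)) := by
    rw [mul_comm]; exact hT1
  exact sliceTest_abs_le_of_transport hν.le ((hu τ hτ').of_le (by norm_cast)) hU hW hπ hmom hdivU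
    (huB τ hτ') l2Dv l2D2v l2U l2DU l2W l2π hTr hη

/-! ### The slice-test increment on a closed slab under an `L⁴` majorant -/

/-- **The slice-test increment on a closed slab under an `L⁴` MAJORANT** (`(u,p)` classical on
`[0,S]×ℝ³` in Tao's class, `0 < t < s < S`; a majorant `√(∫‖u(τ)‖⁴) ≤ m(τ)` on
`(t,s)` which is a.e.-measurable on `(t,s)` with `∫⁻_{(t,s)} ofReal m ≤ ofReal A`, `A ≥ 0`; `η > 0`;
`Z = ∫|Du(t)|²_F`):
`|∫⟪u(s),u(t)⟫ − ∫‖u(t)‖²| ≤ (ν/2)η(∫⁻_{(t,s)}∫⁻|Du|²_F).toReal + (ν/2)η⁻¹Z(s−t) + √Z · A`.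
Proof: the momentum equation on `(t,s)` tested against the frozen regular slice `U = u(t)`
(polarisation `2⟪u,∂ₜu⟫ − 2⟪u−U,∂ₜ(u−U)⟫ = 2⟪U,∂ₜu⟫` and the tree's `L²` balance for `u` and `u − U`),
the static estimate `sliceTest_abs_le_of_classical_L4` at each `τ`, and integration of the three
terms. [folklore] -/
theorem sliceTestL4_increment_abs_le_slab {ν S : ℝ} (hν : 0 < ν) (hS : 0 < S)
    {u : ℝ → EuclideanSpace ℝ (Fin 3) → EuclideanSpace ℝ (Fin 3)} {p : ℝ → EuclideanSpace ℝ (Fin 3) → ℝ}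
    (hsol : IsClassicalNSSolutionOn (Icc 0 S) ν 0 u p) (hB : HasBoundedSobolevNormsOn (Icc 0 S) u)
    {t s : ℝ} (ht : 0 < t) (hts : t < s) (hsS : s < S)
    {m : ℝ → ℝ} (hm : ∀ τ ∈ Ioo t s, Real.sqrt (∫ x, ‖u τ x‖ ^ 4) ≤ m τ)
    (hmeas : AEMeasurable m (volume.restrict (Ioo t s)))
    {A : ℝ} (hA0 : 0 ≤ A) (hA : ∫⁻ τ in Ioo t s, ENNReal.ofReal (m τ) ≤ ENNReal.ofReal A)
    {η : ℝ} (hη : 0 < η) :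
    |(∫ x, ⟪u s x, u t x⟫) - ∫ x, ‖u t x‖ ^ 2| ≤
      ν / 2 * η *
          (∫⁻ τ in Ioo t s, ∫⁻ x, ENNReal.ofReal (frobeniusNormSq (fderiv ℝ (u τ) x))).toReal +
        ν / 2 * η⁻¹ * (∫ x, frobeniusNormSq (fderiv ℝ (u t) x)) * (s - t) +
        Real.sqrt (∫ x, frobeniusNormSq (fderiv ℝ (u t) x)) * A := by
  have hUI : UniqueDiffOn ℝ (Icc 0 S) := uniqueDiffOn_Icc hS
  have hu : ∀ τ ∈ Icc 0 S, ContDiff ℝ ∞ (u τ) := fun τ hτ => hsol.contDiff_velocity hτ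
  have htI : t ∈ Ioc 0 S := ⟨ht, (hts.trans hsS).le⟩
  have htI' : t ∈ Icc 0 S := ⟨ht.le, htI.2⟩
  have hsI : s ∈ Ioc 0 S := ⟨ht.trans hts, hsS.le⟩
  set U : EuclideanSpace ℝ (Fin 3) → EuclideanSpace ℝ (Fin 3) := u t with hUdef
  have hUs : ContDiff ℝ ∞ U := hu t htI'
  have hU1 : ContDiff ℝ 1 U := hUs.of_le (by norm_cast)
  have cU : Continuous U := hUs.continuous
  have hdivU : VectorCalculus.IsDivFree U := hsol.divFree t htI'
  obtain ⟨C₀, hC₀⟩ := hB 0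
  obtain ⟨C₁, hC₁⟩ := hB 1
  have hzero : ∀ σ ∈ Icc 0 S, ∫⁻ x, ‖u σ x‖ₑ ^ 2 ≤ C₀ := fun σ hσ => by
    refine (le_of_eq (lintegral_congr fun x => ?_)).trans (hC₀ σ hσ)
    rw [← ofReal_norm, ← ofReal_norm, norm_iteratedFDeriv_zero]
  have l2sl : ∀ τ ∈ Icc 0 S, ∫⁻ x, ‖u τ x‖ₑ ^ 2 < ⊤ := fun τ hτ =>
    (hzero τ hτ).trans_lt ENNReal.coe_lt_top
  have cut : ∀ τ ∈ Icc 0 S, Continuous (u τ) := fun τ hτ => (hu τ hτ).continuous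
  have hmu : ∀ τ ∈ Icc 0 S, MemLp (u τ) 2 volume := fun τ hτ =>
    memLp_two_of_lintegral_lt_top (cut τ hτ) (l2sl τ hτ)
  have l2U : ∫⁻ x, ‖U x‖ₑ ^ 2 < ⊤ := l2sl t htI'
  have hmU : MemLp U 2 volume := hmu t htI'
  have l2DU : ∫⁻ x, ‖fderiv ℝ U x‖ₑ ^ 2 < ⊤ :=
    lintegral_enorm_sq_lt_top_of_norm_le (fun x => by
      rw [← norm_iteratedFDeriv_fderiv, norm_iteratedFDeriv_zero])
      ((hC₁ t htI').trans_lt ENNReal.coe_lt_top)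
  obtain ⟨Λ, hΛtop, hΛ⟩ := hsol.exists_lintegral_enorm_timeDerivWithin_sq_le hν.le hS hB
  set W : ℝ → EuclideanSpace ℝ (Fin 3) → EuclideanSpace ℝ (Fin 3) := timeDerivWithin (Icc 0 S) u
    with hWdef
  have hWsm : IsSmoothSpaceTimeOn (Icc 0 S) W := hsol.smooth_velocity.timeDerivWithin hUI
  have cWt : ∀ τ ∈ Icc 0 S, Continuous (W τ) := fun τ hτ => (hWsm.contDiff_slice hτ).continuous
  have l2Wt : ∀ τ ∈ Icc 0 S, ∫⁻ x, ‖W τ x‖ₑ ^ 2 < ⊤ := fun τ hτ => (hΛ τ hτ).trans_lt hΛtop.lt_top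
  have hC₁u : ∀ τ ∈ Icc 0 S, ∫⁻ x, ‖timeDerivWithin (Icc 0 S) u τ x‖ₑ ^ 2 ≤ Λ.toNNReal := by
    intro τ hτ; rw [ENNReal.coe_toNNReal hΛtop]; exact hΛ τ hτ
  obtain ⟨hΦu_int, -, hEu⟩ := hsol.smooth_velocity.l2_balance hS hzero hC₁u
  obtain ⟨w, hwdef⟩ : ∃ w : ℝ → EuclideanSpace ℝ (Fin 3) → EuclideanSpace ℝ (Fin 3),
      w = fun τ x => u τ x - U x := ⟨_, rfl⟩
  have hwtx : ∀ τ x, w τ x = u τ x - U x := fun τ x => by rw [hwdef]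
  have hconst : IsSmoothSpaceTimeOn (Icc 0 S) (fun (_ : ℝ) (x : EuclideanSpace ℝ (Fin 3)) => U x) := by
    have hc : ContDiff ℝ ∞ (uncurry fun (_ : ℝ) (x : EuclideanSpace ℝ (Fin 3)) => U x) :=
      hUs.comp contDiff_snd
    exact hc.contDiffOn
  have hwsm : IsSmoothSpaceTimeOn (Icc 0 S) w := by
    rw [hwdef]; exact hsol.smooth_velocity.sub hconst
  have hWt : ∀ τ ∈ Icc 0 S, ∀ x, timeDerivWithin (Icc 0 S) w τ x = W τ x := by
    intro τ hτ x
    rw [hwdef, hsol.smooth_velocity.timeDerivWithin_fun_sub hconst hUI hτ x]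
    simp [hWdef, timeDerivWithin_apply]
  have hwL2 : ∀ τ ∈ Icc 0 S, ∫⁻ x, ‖w τ x‖ₑ ^ 2 ≤ (2 * C₀ + 2 * (∫⁻ x, ‖U x‖ₑ ^ 2).toNNReal : ℝ≥0) := by
    intro τ hτ
    have h := lintegral_enorm_sq_sub_le (g := U) ((cut τ hτ).aestronglyMeasurable) (μ := volume)
    calc ∫⁻ x, ‖w τ x‖ₑ ^ 2 = ∫⁻ x, ‖u τ x - U x‖ₑ ^ 2 := lintegral_congr fun x => by rw [hwtx]
      _ ≤ 2 * (∫⁻ x, ‖u τ x‖ₑ ^ 2) + 2 * ∫⁻ x, ‖U x‖ₑ ^ 2 := h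
      _ ≤ 2 * (C₀ : ℝ≥0∞) + 2 * ((∫⁻ x, ‖U x‖ₑ ^ 2).toNNReal : ℝ≥0∞) := by
          gcongr
          · exact hzero τ hτ
          · exact le_of_eq (ENNReal.coe_toNNReal l2U.ne).symm
      _ = ((2 * C₀ + 2 * (∫⁻ x, ‖U x‖ₑ ^ 2).toNNReal : ℝ≥0) : ℝ≥0∞) := by push_cast; rfl
  have hWL2 : ∀ τ ∈ Icc 0 S, ∫⁻ x, ‖timeDerivWithin (Icc 0 S) w τ x‖ₑ ^ 2 ≤ Λ.toNNReal := by
    intro τ hτ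
    rw [ENNReal.coe_toNNReal hΛtop]
    refine (le_of_eq (lintegral_congr fun x => ?_)).trans (hΛ τ hτ)
    rw [hWt τ hτ x]
  obtain ⟨hΦw_int, -, hEw⟩ := hwsm.l2_balance hS hwL2 hWL2
  set Φu : ℝ → ℝ := fun τ => ∫ x, 2 * ⟪u τ x, timeDerivWithin (Icc 0 S) u τ x⟫ with hΦu
  set Φw : ℝ → ℝ := fun τ => ∫ x, 2 * ⟪w τ x, timeDerivWithin (Icc 0 S) w τ x⟫ with hΦw
  set Ψ : ℝ → ℝ := fun τ => (Φu τ - Φw τ) / 2 with hΨ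
  set P : ℝ → ℝ := fun τ => ∫ x, ⟪u τ x, U x⟫ with hP
  have hΨ_int : IntegrableOn Ψ (Ioo 0 S) := (hΦu_int.sub hΦw_int).div_const 2
  have hpol : ∀ τ ∈ Icc 0 S, P τ = ((∫ x, ‖u τ x‖ ^ 2) + (∫ x, ‖U x‖ ^ 2) - ∫ x, ‖w τ x‖ ^ 2) / 2 := by
    intro τ hτ
    have h := integral_norm_sub_sq_eq (hmu τ hτ) hmU
    have hw' : ∫ x, ‖w τ x‖ ^ 2 = ∫ x, ‖u τ x - U x‖ ^ 2 :=
      integral_congr_ae (Eventually.of_forall fun x => by simp only [hwtx])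
    simp only [hP]
    rw [hw', h]
    ring
  have hincr : ∀ b ∈ Ioc 0 S, P b - P 0 = ∫ τ in (0 : ℝ)..b, Ψ τ := by
    intro b hb
    have h0 : (0 : ℝ) ∈ Icc 0 S := ⟨le_rfl, hS.le⟩
    have hbI : b ∈ Icc 0 S := ⟨hb.1.le, hb.2⟩
    have e1 := hEu b hb
    have e2 := hEw b hb
    have hiu : IntervalIntegrable Φu volume 0 b :=
      (intervalIntegrable_iff_integrableOn_Ioo_of_le hb.1.le).2
        (hΦu_int.mono_set (Ioo_subset_Ioo le_rfl hb.2))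
    have hiw : IntervalIntegrable Φw volume 0 b :=
      (intervalIntegrable_iff_integrableOn_Ioo_of_le hb.1.le).2
        (hΦw_int.mono_set (Ioo_subset_Ioo le_rfl hb.2))
    have e3 : ∫ τ in (0 : ℝ)..b, Ψ τ = ((∫ τ in (0 : ℝ)..b, Φu τ) - ∫ τ in (0 : ℝ)..b, Φw τ) / 2 := by
      simp only [hΨ]
      rw [intervalIntegral.integral_div, intervalIntegral.integral_sub hiu hiw]
    rw [e3, hpol b hbI, hpol 0 h0]
    simp only [hΦu, hΦw] at e1 e2 ⊢
    linarith
  have hΨii : ∀ a b : ℝ, 0 ≤ a → b ≤ S → a ≤ b → IntervalIntegrable Ψ volume a b :=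
    fun a b ha hb hab =>
      (intervalIntegrable_iff_integrableOn_Ioo_of_le hab).2 (hΨ_int.mono_set (Ioo_subset_Ioo ha hb))
  have hPst : P s - P t = ∫ τ in Ioo t s, Ψ τ := by
    have h1 := hincr s hsI
    have h2 := hincr t htI
    have h3 := intervalIntegral.integral_interval_sub_left (hΨii 0 s le_rfl hsI.2 hsI.1.le)
      (hΨii 0 t le_rfl htI.2 htI.1.le)
    rw [intervalIntegral.integral_of_le hts.le, integral_Ioc_eq_integral_Ioo] at h3
    linarith
  have hΨeq : ∀ τ ∈ Icc 0 S, Ψ τ = ∫ x, ⟪U x, W τ x⟫ := by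
    intro τ hτ
    have iu : Integrable (fun x => 2 * ⟪u τ x, timeDerivWithin (Icc 0 S) u τ x⟫) volume := by
      refine (integrable_of_norm_le_mul_of_lintegral_sq ((cut τ hτ).inner (cWt τ hτ)).aestronglyMeasurable
        (cut τ hτ) (cWt τ hτ) (l2sl τ hτ) (l2Wt τ hτ) fun x => norm_inner_le_norm _ _).const_mul 2
    have cwt : Continuous (w τ) := (hwsm.contDiff_slice hτ).continuous
    have l2wt : ∫⁻ x, ‖w τ x‖ₑ ^ 2 < ⊤ := (hwL2 τ hτ).trans_lt ENNReal.coe_lt_top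
    have iw : Integrable (fun x => 2 * ⟪w τ x, timeDerivWithin (Icc 0 S) w τ x⟫) volume := by
      have h1 : Integrable (fun x => ⟪w τ x, W τ x⟫) volume :=
        integrable_of_norm_le_mul_of_lintegral_sq (cwt.inner (cWt τ hτ)).aestronglyMeasurable
          cwt (cWt τ hτ) l2wt (l2Wt τ hτ) fun x => norm_inner_le_norm _ _
      refine (h1.const_mul 2).congr (Eventually.of_forall fun x => ?_)
      simp only [hWt τ hτ x]
    simp only [hΨ, hΦu, hΦw]
    rw [← integral_sub iu iw]
    have hpt : (fun x => 2 * ⟪u τ x, timeDerivWithin (Icc 0 S) u τ x⟫ -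
        2 * ⟪w τ x, timeDerivWithin (Icc 0 S) w τ x⟫) = fun x => 2 * ⟪U x, W τ x⟫ := by
      funext x
      rw [hWt τ hτ x, hwtx, inner_sub_left, real_inner_comm (W τ x) (U x)]
      simp only [hWdef]
      ring
    rw [hpt, integral_const_mul]
    ring
  set ZU : ℝ := ∫ x, frobeniusNormSq (fderiv ℝ U x) with hZU
  set a : ℝ := ν / 2 * η with ha
  set K : ℝ := ν / 2 * η⁻¹ * ZU with hK
  set c : ℝ := Real.sqrt ZU with hc
  set F : ℝ → ℝ≥0∞ := fun τ => ∫⁻ x, ENNReal.ofReal (frobeniusNormSq (fderiv ℝ (u τ) x)) with hF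
  have ha0 : 0 ≤ a := by rw [ha]; positivity
  have hZU0 : 0 ≤ ZU := integral_nonneg fun x => frobeniusNormSq_nonneg _
  have hK0 : 0 ≤ K := by rw [hK]; positivity
  have hc0 : 0 ≤ c := Real.sqrt_nonneg _
  have hm0 : ∀ τ ∈ Ioo t s, 0 ≤ m τ := fun τ hτ => (Real.sqrt_nonneg _).trans (hm τ hτ)
  have hbound : ∀ τ ∈ Ioo t s, ENNReal.ofReal ‖Ψ τ‖ ≤
      ENNReal.ofReal a * F τ + ENNReal.ofReal K + ENNReal.ofReal (c * m τ) := by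
    intro τ hτ
    have hτS : τ ∈ Ioo 0 S := ⟨ht.trans hτ.1, hτ.2.trans hsS⟩
    have hτS' : τ ∈ Icc 0 S := Ioo_subset_Icc_self hτS
    have hest := sliceTest_abs_le_of_classical_L4 hν hS hsol hB hτS hU1 hdivU l2U l2DU hη
    rw [← hΨeq τ hτS'] at hest
    have hGeq : ∫ x, frobeniusNormSq (fderiv ℝ (u τ) x) = (F τ).toReal :=
      integral_eq_lintegral_of_nonneg_ae (Eventually.of_forall fun x => frobeniusNormSq_nonneg _)
        (continuous_frobeniusNormSq_fderiv (hu τ hτS') (by simp)).aestronglyMeasurable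
    have hFfin : F τ ≠ ⊤ := by
      refine (lt_of_le_of_lt ?_ (ENNReal.mul_lt_top (by norm_num : (3 : ℝ≥0∞) < ⊤)
        ((hC₁ τ hτS').trans_lt ENNReal.coe_lt_top))).ne
      calc F τ ≤ ∫⁻ x, 3 * ‖fderiv ℝ (u τ) x‖ₑ ^ 2 :=
            lintegral_mono fun x => ofReal_frobeniusNormSq_le_three_mul_enorm_sq _
        _ = 3 * ∫⁻ x, ‖fderiv ℝ (u τ) x‖ₑ ^ 2 := lintegral_const_mul' _ _ (by norm_num)
        _ = 3 * ∫⁻ x, ‖iteratedFDeriv ℝ 1 (u τ) x‖ₑ ^ 2 := by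
            congr 1
            exact lintegral_congr fun x => by
              rw [← ofReal_norm, ← ofReal_norm, ← norm_iteratedFDeriv_fderiv, norm_iteratedFDeriv_zero]
    have htrans : Real.sqrt (∫ x, ‖u τ x‖ ^ 4) * Real.sqrt ZU ≤ c * m τ := by
      rw [hc, mul_comm]
      exact mul_le_mul_of_nonneg_left (hm τ hτ) (Real.sqrt_nonneg _)
    have hrate0 : 0 ≤ c * m τ := mul_nonneg hc0 (hm0 τ hτ)
    have halg : ν / 2 * (η * (F τ).toReal + η⁻¹ * ZU) = a * (F τ).toReal + K := by
      rw [ha, hK]; ring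
    rw [Real.norm_eq_abs]
    calc ENNReal.ofReal |Ψ τ|
        ≤ ENNReal.ofReal (a * (F τ).toReal + K + c * m τ) := by
          refine ENNReal.ofReal_le_ofReal ?_
          rw [← halg, ← hGeq]
          exact hest.trans (add_le_add le_rfl htrans)
      _ = ENNReal.ofReal a * F τ + ENNReal.ofReal K + ENNReal.ofReal (c * m τ) := by
          rw [ENNReal.ofReal_add (by positivity) hrate0, ENNReal.ofReal_add (by positivity) hK0,
            ENNReal.ofReal_mul ha0, ENNReal.ofReal_toReal hFfin]
  -- the majorant integral
  have hmeas' : AEMeasurable (fun τ => ENNReal.ofReal (c * m τ)) (volume.restrict (Ioo t s)) :=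
    ENNReal.measurable_ofReal.comp_aemeasurable (hmeas.const_mul c)
  have hrate : ∫⁻ τ in Ioo t s, ENNReal.ofReal (c * m τ) ≤ ENNReal.ofReal (c * A) := by
    have h1 : ∫⁻ τ in Ioo t s, ENNReal.ofReal (c * m τ) =
        ENNReal.ofReal c * ∫⁻ τ in Ioo t s, ENNReal.ofReal (m τ) := by
      rw [← lintegral_const_mul' _ _ ENNReal.ofReal_ne_top]
      exact lintegral_congr fun τ => ENNReal.ofReal_mul hc0
    rw [h1, ENNReal.ofReal_mul hc0]
    exact mul_le_mul' le_rfl hA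
  set Rt : ℝ := c * A with hRt
  have hRt0 : 0 ≤ Rt := mul_nonneg hc0 hA0
  have hlin : ∫⁻ τ in Ioo t s, ENNReal.ofReal ‖Ψ τ‖ ≤
      ENNReal.ofReal a * (∫⁻ τ in Ioo t s, F τ) + ENNReal.ofReal K * ENNReal.ofReal (s - t) +
        ENNReal.ofReal Rt := by
    calc ∫⁻ τ in Ioo t s, ENNReal.ofReal ‖Ψ τ‖
        ≤ ∫⁻ τ in Ioo t s,
            (ENNReal.ofReal a * F τ + ENNReal.ofReal K + ENNReal.ofReal (c * m τ)) :=
          setLIntegral_mono' measurableSet_Ioo fun τ hτ => hbound τ hτ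
      _ = ENNReal.ofReal a * (∫⁻ τ in Ioo t s, F τ) + ENNReal.ofReal K * ENNReal.ofReal (s - t) +
            ∫⁻ τ in Ioo t s, ENNReal.ofReal (c * m τ) := by
          rw [lintegral_add_right' _ hmeas', lintegral_add_right _ measurable_const,
            lintegral_const_mul' _ _ ENNReal.ofReal_ne_top,
            lintegral_const, Measure.restrict_apply MeasurableSet.univ, univ_inter, Real.volume_Ioo]
      _ ≤ _ := add_le_add le_rfl hrate
  have hDfin : (∫⁻ τ in Ioo t s, F τ) ≠ ⊤ := by
    have hle : ∀ τ ∈ Ioo t s, F τ ≤ 3 * (C₁ : ℝ≥0∞) := by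
      intro τ hτ
      have hτS' : τ ∈ Icc 0 S := ⟨(ht.trans hτ.1).le, (hτ.2.trans hsS).le⟩
      calc F τ ≤ ∫⁻ x, 3 * ‖fderiv ℝ (u τ) x‖ₑ ^ 2 :=
            lintegral_mono fun x => ofReal_frobeniusNormSq_le_three_mul_enorm_sq _
        _ = 3 * ∫⁻ x, ‖fderiv ℝ (u τ) x‖ₑ ^ 2 := lintegral_const_mul' _ _ (by norm_num)
        _ ≤ 3 * (C₁ : ℝ≥0∞) := by
            refine mul_le_mul' le_rfl ((le_of_eq (lintegral_congr fun x => ?_)).trans (hC₁ τ hτS'))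
            rw [← ofReal_norm, ← ofReal_norm, ← norm_iteratedFDeriv_fderiv, norm_iteratedFDeriv_zero]
    refine (lt_of_le_of_lt (setLIntegral_mono' measurableSet_Ioo fun τ hτ => hle τ hτ) ?_).ne
    rw [lintegral_const, Measure.restrict_apply MeasurableSet.univ, univ_inter, Real.volume_Ioo]
    exact ENNReal.mul_lt_top (ENNReal.mul_lt_top (by norm_num) ENNReal.coe_lt_top) ENNReal.ofReal_lt_top
  have hnorm := norm_integral_le_lintegral_norm (μ := volume.restrict (Ioo t s)) Ψ
  rw [Real.norm_eq_abs] at hnorm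
  have hfinR : ENNReal.ofReal a * (∫⁻ τ in Ioo t s, F τ) + ENNReal.ofReal K * ENNReal.ofReal (s - t) +
      ENNReal.ofReal Rt ≠ ⊤ :=
    ENNReal.add_ne_top.2 ⟨ENNReal.add_ne_top.2 ⟨ENNReal.mul_ne_top ENNReal.ofReal_ne_top hDfin,
      ENNReal.mul_ne_top ENNReal.ofReal_ne_top ENNReal.ofReal_ne_top⟩, ENNReal.ofReal_ne_top⟩
  have htoReal : (∫⁻ τ in Ioo t s, ENNReal.ofReal ‖Ψ τ‖).toReal ≤
      a * (∫⁻ τ in Ioo t s, F τ).toReal + K * (s - t) + Rt := by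
    have h := (ENNReal.toReal_le_toReal (ne_top_of_le_ne_top hfinR hlin) hfinR).2 hlin
    rw [ENNReal.toReal_add (ENNReal.add_ne_top.2 ⟨ENNReal.mul_ne_top ENNReal.ofReal_ne_top hDfin,
        ENNReal.mul_ne_top ENNReal.ofReal_ne_top ENNReal.ofReal_ne_top⟩) ENNReal.ofReal_ne_top,
      ENNReal.toReal_add (ENNReal.mul_ne_top ENNReal.ofReal_ne_top hDfin)
        (ENNReal.mul_ne_top ENNReal.ofReal_ne_top ENNReal.ofReal_ne_top), ENNReal.toReal_mul,
      ENNReal.toReal_mul, ENNReal.toReal_ofReal ha0, ENNReal.toReal_ofReal hK0,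
      ENNReal.toReal_ofReal (by linarith), ENNReal.toReal_ofReal hRt0] at h
    exact h
  have hPt : P t = ∫ x, ‖u t x‖ ^ 2 := by
    simp only [hP, hUdef]
    exact integral_congr_ae (Eventually.of_forall fun x => real_inner_self_eq_norm_sq _)
  have hgoal : (∫ x, ⟪u s x, u t x⟫) - ∫ x, ‖u t x‖ ^ 2 = P s - P t := by
    rw [hPt]
  rw [hgoal, hPst]
  refine (hnorm.trans htoReal).trans (le_of_eq ?_)
  simp only [ha, hK, hRt, hc, hZU]

end NoTerminalJolt

end Summit.NavierStokesRegularity.NavierStokesRegularity.Theorems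

end
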